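import Summits.ABC.ABC.Theorems.CuspFieldPencilGoldenCuspData
import Summits.ABC.ABC.Theorems.YuMatveevShapeRatCloses
import Summits.ABC.ABC.Theses.CuspFieldPencil
import HarnessLib

/-!
# Golden cusp shadow, FILE C — pre-bound, endgame, cusp swap, min-form: crux stmt-ABC-26026 by name

FILE C of three (`CuspFieldPencilGoldenCuspPlaces` ⟵ `CuspFieldPencilGoldenCuspData` ⟵ `CuspFieldPencilGoldenCuspShadow`).
From FILE A (`orl_*`, `endgame_abstract`) and FILE B (cusp data) it proves, for coprime `u, w` with
`u·w·(u² − 11uw − w²) ≠ 0` and every `ε > 0` (`R = |rad(u·w·(u² − 11uw − w²))|`):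

* `routeU_holds`  : `log max(|u|,|w|) ≤ κ_ε · R^ε · |rad u|` — the engine hypothesis discharged by the KERNEL theorem
  `Summit.ABC.ABC.Theorems.approximationBound_rat_holds : ∃ K ≥ 1, PastenApproximationBound K`;
* `routeW_holds`  : the same with `|rad w|` (cusp swap `(u, w) ↦ (w, −u)`, the product `u·w·Q` is literally invariant);
* `cuspMinRadBound_holds` : `… ≤ κ_ε · R^ε · min(|rad u|, |rad w|)`;
* `stub_splitCuspTriple` : the registered birth-skeleton stub (verbatim signature; `min ≤ (rad u·rad w)^{2/3}·rad(Q)^{1/3}`);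
* `goldenCuspShadow_proof : Summit.ABC.ABC.Theses.CuspFieldPencil.GoldenCuspShadow` (`min² ≤ rad u·rad w ≤ R`).

HONESTY. A CLASS statement for ONE binary quartic form inside the Baker/LFL technique class (exponent `1/2 + ε` of the
radical inside the exponential, free constant `κ_ε`); not abc, not an all-triples rung; consistent with
`Literature.Barriers.ABC.BakerMethodBounds*` / `EpsilonCannotBeDropped` (the `R^ε` is kept).
References: [cite: Pasten2024, Theorem 2.1, §5]; [cite: EvertseGyory2015, Thm 4.2.1 p. 68, §4.6]; [folklore].
-/

set_option linter.dupNamespace false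

noncomputable section

open Finset Real Height
open Literature.NumberTheory.DiophantineGeometry
open Literature.NumberTheory.DiophantineGeometry.Dioph
open Literature.NumberTheory.DiophantineGeometry.Pasten
open Literature.Barriers.ABC

namespace Summit.ABC.ABC.Theorems

namespace GoldenCuspShadowBaker

/-! ## §1 Sizes and the pre-bound -/

/-- **D4 [S]** sizes: `Y ≤ log max(e, 2y)` with the LINEARISED variable `y = log 13 + 2 log H` (k2-g5):
`|Q| ≤ 13H²`, `w² ≤ H²`, so `log|Q| + log w² ≤ log 13 + 4 log H ≤ 2y`. -/
theorem Ycall_le {u w : ℤ} (h0 : u * w * (u ^ 2 - 11 * u * w - w ^ 2) ≠ 0) :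
    (Real.log (max (Real.exp 1) (Real.log (((u ^ 2 - 11 * u * w - w ^ 2).natAbs : ℕ) : ℝ) + Real.log (((w.natAbs ^ 2 : ℕ)) : ℝ)))) ≤ Real.log (max (Real.exp 1) (2 * (Real.log 13 + 2 * Real.log ((max |(u : ℝ)| |(w : ℝ)|))))) := by
  have hu : u ≠ 0 := by rintro rfl; simp at h0
  have hw : w ≠ 0 := by rintro rfl; simp at h0
  have hQ : (u ^ 2 - 11 * u * w - w ^ 2) ≠ 0 := by intro hq; apply h0; rw [hq, mul_zero]
  have hw' : (w : ℝ) ≠ 0 := by exact_mod_cast hw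
  have hQ' : (((u ^ 2 - 11 * u * w - w ^ 2) : ℤ) : ℝ) ≠ 0 := by exact_mod_cast hQ
  set Hr := (max |(u : ℝ)| |(w : ℝ)|) with hHr
  have hxH : |(u : ℝ)| ≤ Hr := le_max_left _ _
  have hyH : |(w : ℝ)| ≤ Hr := le_max_right _ _
  have hH1 : 1 ≤ Hr := by
    have : (1 : ℝ) ≤ |(u : ℝ)| := by exact_mod_cast Int.one_le_abs hu
    exact this.trans hxH
  have hH0 : 0 ≤ Hr := zero_le_one.trans hH1
  have hx2 : (u : ℝ) ^ 2 ≤ Hr ^ 2 := by rw [← sq_abs]; exact pow_le_pow_left₀ (abs_nonneg _) hxH 2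
  have hy2 : (w : ℝ) ^ 2 ≤ Hr ^ 2 := by rw [← sq_abs]; exact pow_le_pow_left₀ (abs_nonneg _) hyH 2
  have hxy : |(u : ℝ) * w| ≤ Hr ^ 2 := by
    rw [abs_mul, sq]; exact mul_le_mul hxH hyH (abs_nonneg _) hH0
  have hQle : |(((u ^ 2 - 11 * u * w - w ^ 2) : ℤ) : ℝ)| ≤ 13 * Hr ^ 2 := by
    show |((u ^ 2 - 11 * u * w - w ^ 2 : ℤ) : ℝ)| ≤ _
    push_cast
    rw [abs_le]
    constructor <;> nlinarith [le_abs_self ((u : ℝ) * w), neg_abs_le ((u : ℝ) * w), sq_nonneg (u : ℝ),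
      sq_nonneg (w : ℝ)]
  have hlogQ : Real.log (((u ^ 2 - 11 * u * w - w ^ 2).natAbs : ℕ) : ℝ) ≤ Real.log 13 + 2 * Real.log Hr := by
    rw [Nat.cast_natAbs, Int.cast_abs]
    calc Real.log |(((u ^ 2 - 11 * u * w - w ^ 2) : ℤ) : ℝ)| ≤ Real.log (13 * Hr ^ 2) := Real.log_le_log (abs_pos.mpr hQ') hQle
      _ = Real.log 13 + 2 * Real.log Hr := by
          rw [Real.log_mul (by norm_num) (pow_ne_zero _ (by linarith)), Real.log_pow]; norm_num
  have hlogw : Real.log (((w.natAbs ^ 2 : ℕ)) : ℝ) ≤ 2 * Real.log Hr := by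
    rw [Nat.cast_pow, Nat.cast_natAbs, Int.cast_abs, Real.log_pow]
    have := Real.log_le_log (abs_pos.mpr hw') hyH
    push_cast; linarith
  have h13 : (0 : ℝ) ≤ Real.log 13 := Real.log_nonneg (by norm_num)
  exact log_max_exp_mono (by linarith)

/-- **D5 [M−, ≈50 ll.]** the PRE-BOUND for the linearised variable: for every `η > 0` a constant `A ≥ 1` with
`y ≤ A · R^η · rad u · log max(e, 2y)`, `y = log 13 + 2 log H`, for ALL admissible pairs
(`C` from R5 with `A := K`; off the escape: C1 + C2 + D2 + D3 + D4, `log H ≤ log 12 + Θ₀Y(1 + 3Σ)`, `A := log 1872 + 8KC`;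
at the escape: B7, `y = log 1573 ≤ A`, all other factors `≥ 1`). -/
theorem pre_routeU {K : ℝ} (hK : 1 ≤ K) (hP : PastenApproximationBound K) {η : ℝ} (hη : 0 < η) :
    ∃ A : ℝ, 1 ≤ A ∧ ∀ u w : ℤ, IsCoprime u w → u * w * (u ^ 2 - 11 * u * w - w ^ 2) ≠ 0 →
      Real.log 13 + 2 * Real.log ((max |(u : ℝ)| |(w : ℝ)|)) ≤
        A * (((UniqueFactorizationMonoid.radical (u * w * (u ^ 2 - 11 * u * w - w ^ 2))).natAbs : ℕ) : ℝ) ^ η * (((UniqueFactorizationMonoid.radical u).natAbs : ℕ) : ℝ) *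
          Real.log (max (Real.exp 1) (2 * (Real.log 13 + 2 * Real.log ((max |(u : ℝ)| |(w : ℝ)|))))) := by
  obtain ⟨C, hC1, hC⟩ := SingleTowerSzpiroLine.exists_prod_mul_log_div_rpow_le (zero_le_one.trans hK) hη
  have h13 : 0 ≤ Real.log 13 := Real.log_nonneg (by norm_num)
  have h12 : 0 ≤ Real.log 12 := Real.log_nonneg (by norm_num)
  have hKC : 1 ≤ K * C := one_le_mul_of_one_le_of_one_le hK hC1
  refine ⟨Real.log 13 + 2 * Real.log 12 + 8 * K * C, by linarith, fun u w h h0 => ?_⟩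
  have hu : u ≠ 0 := by rintro rfl; simp at h0
  set Hr := (max |(u : ℝ)| |(w : ℝ)|) with hHr
  set Rr : ℝ := (((UniqueFactorizationMonoid.radical (u * w * (u ^ 2 - 11 * u * w - w ^ 2))).natAbs : ℕ) : ℝ) with hRr
  set L := Real.log (max (Real.exp 1) (2 * (Real.log 13 + 2 * Real.log Hr))) with hL
  have hL1 : 1 ≤ L := one_le_log_max_exp _
  have hRr1 : 1 ≤ Rr := one_le_radR _
  have hRη1 : 1 ≤ Rr ^ η := Real.one_le_rpow hRr1 hη.le
  have hru1 : 1 ≤ (((UniqueFactorizationMonoid.radical u).natAbs : ℕ) : ℝ) := one_le_radR u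
  have hP1 : 1 ≤ Rr ^ η * (((UniqueFactorizationMonoid.radical u).natAbs : ℕ) : ℝ) * L :=
    one_le_mul_of_one_le_of_one_le (one_le_mul_of_one_le_of_one_le hRη1 hru1) hL1
  have hA0 : 0 ≤ Real.log 13 + 2 * Real.log 12 + 8 * K * C := by linarith
  rcases eq_or_ne (u - 11 * w) 0 with he | hne
  · -- the escape `(u, w) = ±(11, 1)`: `H = 11`, the bound is a constant
    have hH : Hr = 11 := escape h he
    have hy : Real.log 13 + 2 * Real.log Hr ≤ Real.log 13 + 2 * Real.log 12 + 8 * K * C := by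
      rw [hH]
      have : Real.log 11 ≤ Real.log 12 := Real.log_le_log (by norm_num) (by norm_num)
      linarith
    calc Real.log 13 + 2 * Real.log Hr ≤ (Real.log 13 + 2 * Real.log 12 + 8 * K * C) * 1 := by linarith
      _ ≤ (Real.log 13 + 2 * Real.log 12 + 8 * K * C) * (Rr ^ η * (((UniqueFactorizationMonoid.radical u).natAbs : ℕ) : ℝ) * L) :=
          mul_le_mul_of_nonneg_left hP1 hA0
      _ = _ := by ring
  · -- generic pair: C1 + C2 + D2 + D3 + D4
    have hC1' := cusp_padic hK hP h h0 hne
    have hC2 := cusp_transfer hK hP h h0 hne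
    have hTh : (theta K (u ^ 2 - 11 * u * w - w ^ 2).natAbs (w.natAbs ^ 2) 0) ≤ K * C * Rr ^ η := theta_call_le hK hη.le hC h h0
    have hTh0 : 0 ≤ (theta K (u ^ 2 - 11 * u * w - w ^ 2).natAbs (w.natAbs ^ 2) 0) := theta_nonneg (zero_le_one.trans hK) _ _ _
    have hY : (Real.log (max (Real.exp 1) (Real.log (((u ^ 2 - 11 * u * w - w ^ 2).natAbs : ℕ) : ℝ) + Real.log (((w.natAbs ^ 2 : ℕ)) : ℝ)))) ≤ L := Ycall_le h0
    have hY0 : 0 ≤ (Real.log (max (Real.exp 1) (Real.log (((u ^ 2 - 11 * u * w - w ^ 2).natAbs : ℕ) : ℝ) + Real.log (((w.natAbs ^ 2 : ℕ)) : ℝ)))) := zero_le_one.trans (one_le_log_max_exp _)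
    have hS : 1 + 3 * ∑ p ∈ u.natAbs.primeFactors, (p : ℝ) ≤ 4 * (((UniqueFactorizationMonoid.radical u).natAbs : ℕ) : ℝ) := one_add_three_sum_le u
    have hS0 : 0 ≤ ∑ p ∈ u.natAbs.primeFactors, (p : ℝ) := Finset.sum_nonneg fun p _ => Nat.cast_nonneg p
    have hKCR : 0 ≤ K * C * Rr ^ η := mul_nonneg (by linarith) (by linarith)
    have h1 : Real.log Hr ≤
        Real.log 12 + (theta K (u ^ 2 - 11 * u * w - w ^ 2).natAbs (w.natAbs ^ 2) 0) * (Real.log (max (Real.exp 1) (Real.log (((u ^ 2 - 11 * u * w - w ^ 2).natAbs : ℕ) : ℝ) + Real.log (((w.natAbs ^ 2 : ℕ)) : ℝ)))) * (1 + 3 * ∑ p ∈ u.natAbs.primeFactors, (p : ℝ)) := by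
      linarith
    have h2 : (theta K (u ^ 2 - 11 * u * w - w ^ 2).natAbs (w.natAbs ^ 2) 0) * (Real.log (max (Real.exp 1) (Real.log (((u ^ 2 - 11 * u * w - w ^ 2).natAbs : ℕ) : ℝ) + Real.log (((w.natAbs ^ 2 : ℕ)) : ℝ)))) * (1 + 3 * ∑ p ∈ u.natAbs.primeFactors, (p : ℝ)) ≤
        K * C * Rr ^ η * L * (4 * (((UniqueFactorizationMonoid.radical u).natAbs : ℕ) : ℝ)) :=
      mul_le_mul (mul_le_mul hTh hY hY0 hKCR) hS (by linarith) (mul_nonneg hKCR (by linarith))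
    calc Real.log 13 + 2 * Real.log Hr
        ≤ Real.log 13 + 2 * Real.log 12 + 8 * K * C * (Rr ^ η * (((UniqueFactorizationMonoid.radical u).natAbs : ℕ) : ℝ) * L) := by linarith
      _ ≤ (Real.log 13 + 2 * Real.log 12) * (Rr ^ η * (((UniqueFactorizationMonoid.radical u).natAbs : ℕ) : ℝ) * L) + 8 * K * C * (Rr ^ η * (((UniqueFactorizationMonoid.radical u).natAbs : ℕ) : ℝ) * L) := by
          have : Real.log 13 + 2 * Real.log 12 ≤ (Real.log 13 + 2 * Real.log 12) * (Rr ^ η * (((UniqueFactorizationMonoid.radical u).natAbs : ℕ) : ℝ) * L) :=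
            le_mul_of_one_le_right (by linarith) hP1
          linarith
      _ = _ := by ring

/-! ## §2 `RouteU` from the engine hypothesis, the cusp swap, the min-form, the exponents -/

/-- **E2 [S]** `RouteU` from the engine: E1 on the index type of admissible pairs with `y := log 13 + 2 log H`,
`R := rad(uwQ)`, `m := rad u` (D5; `1 ≤ rad u ≤ R` by `radR_le_radR_prod`; `log H ≤ y` since `H ≥ 1`). -/
theorem routeU_of_engine {K : ℝ} (hK : 1 ≤ K) (hP : PastenApproximationBound K) :
    ∀ ε : ℝ, 0 < ε → ∃ κ : ℝ, ∀ u w : ℤ, IsCoprime u w → u * w * (u ^ 2 - 11 * u * w - w ^ 2) ≠ 0 →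
    Real.log (max (|(u : ℝ)|) (|(w : ℝ)|)) ≤
      κ * (((UniqueFactorizationMonoid.radical (u * w * (u ^ 2 - 11 * u * w - w ^ 2))).natAbs : ℕ) : ℝ) ^ (ε : ℝ) *
        (((UniqueFactorizationMonoid.radical u).natAbs : ℕ) : ℝ) := by
  have main := @endgame_abstract {p : ℤ × ℤ // IsCoprime p.1 p.2 ∧ p.1 * p.2 * (p.1 ^ 2 - 11 * p.1 * p.2 - p.2 ^ 2) ≠ 0}
    (fun i => Real.log 13 + 2 * Real.log ((max |(i.1.1 : ℝ)| |(i.1.2 : ℝ)|)))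
    (fun i => (((UniqueFactorizationMonoid.radical (i.1.1 * i.1.2 * (i.1.1 ^ 2 - 11 * i.1.1 * i.1.2 - i.1.2 ^ 2))).natAbs : ℕ) : ℝ))
    (fun i => (((UniqueFactorizationMonoid.radical i.1.1).natAbs : ℕ) : ℝ))
    (fun i => one_le_radR _) (fun i => one_le_radR _) (fun i => radR_le_radR_prod i.2.1)
    (fun η hη => by
      obtain ⟨A, -, hA⟩ := pre_routeU hK hP hη
      exact ⟨A, fun i => hA i.1.1 i.1.2 i.2.1 i.2.2⟩)
  intro ε hε
  obtain ⟨κ, hκ⟩ := main ε hε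
  refine ⟨max κ 0, fun u w h h0 => ?_⟩
  set Rr : ℝ := (((UniqueFactorizationMonoid.radical (u * w * (u ^ 2 - 11 * u * w - w ^ 2))).natAbs : ℕ) : ℝ)
    with hRr
  have key : Real.log 13 + 2 * Real.log ((max |(u : ℝ)| |(w : ℝ)|)) ≤ κ * Rr ^ ε * (((UniqueFactorizationMonoid.radical u).natAbs : ℕ) : ℝ) := hκ ⟨(u, w), h, h0⟩
  have hu : u ≠ 0 := by rintro rfl; simp at h0
  have hH1 : 1 ≤ (max |(u : ℝ)| |(w : ℝ)|) := by
    have : (1 : ℝ) ≤ |(u : ℝ)| := by exact_mod_cast Int.one_le_abs hu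
    exact this.trans (le_max_left _ _)
  have hlogH : 0 ≤ Real.log ((max |(u : ℝ)| |(w : ℝ)|)) := Real.log_nonneg hH1
  have h13 : 0 ≤ Real.log 13 := Real.log_nonneg (by norm_num)
  have hRε : 0 ≤ Rr ^ ε := Real.rpow_nonneg (Nat.cast_nonneg _) _
  have hru0 : 0 ≤ (((UniqueFactorizationMonoid.radical u).natAbs : ℕ) : ℝ) := Nat.cast_nonneg _
  calc Real.log ((max |(u : ℝ)| |(w : ℝ)|)) ≤ Real.log 13 + 2 * Real.log ((max |(u : ℝ)| |(w : ℝ)|)) := by linarith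
    _ ≤ κ * Rr ^ ε * (((UniqueFactorizationMonoid.radical u).natAbs : ℕ) : ℝ) := key
    _ ≤ max κ 0 * Rr ^ ε * (((UniqueFactorizationMonoid.radical u).natAbs : ℕ) : ℝ) :=
        mul_le_mul_of_nonneg_right (mul_le_mul_of_nonneg_right (le_max_left _ _) hRε) hru0

/-- **E3 [S]** the cusp swap: `RouteU → RouteW` at `(w, −u)` (`IsCoprime.neg_right`/`.symm`, `prod_swap`, `abs_neg`,
`max_comm`, `Int.radical_neg`/`natAbs_neg`). -/
theorem routeW_of_routeU :
    (∀ ε : ℝ, 0 < ε → ∃ κ : ℝ, ∀ u w : ℤ, IsCoprime u w → u * w * (u ^ 2 - 11 * u * w - w ^ 2) ≠ 0 →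
    Real.log (max (|(u : ℝ)|) (|(w : ℝ)|)) ≤
      κ * (((UniqueFactorizationMonoid.radical (u * w * (u ^ 2 - 11 * u * w - w ^ 2))).natAbs : ℕ) : ℝ) ^ (ε : ℝ) *
        (((UniqueFactorizationMonoid.radical u).natAbs : ℕ) : ℝ)) →
    ∀ ε : ℝ, 0 < ε → ∃ κ : ℝ, ∀ u w : ℤ, IsCoprime u w → u * w * (u ^ 2 - 11 * u * w - w ^ 2) ≠ 0 →
    Real.log (max (|(u : ℝ)|) (|(w : ℝ)|)) ≤
      κ * (((UniqueFactorizationMonoid.radical (u * w * (u ^ 2 - 11 * u * w - w ^ 2))).natAbs : ℕ) : ℝ) ^ (ε : ℝ) *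
        (((UniqueFactorizationMonoid.radical w).natAbs : ℕ) : ℝ) := by
  intro hU ε hε
  obtain ⟨κ, hκ⟩ := hU ε hε
  refine ⟨κ, fun u w h h0 => ?_⟩
  have hprod : w * -u * (w ^ 2 - 11 * w * -u - (-u) ^ 2) = u * w * (u ^ 2 - 11 * u * w - w ^ 2) := by ring
  have h0' : w * -u * (w ^ 2 - 11 * w * -u - (-u) ^ 2) ≠ 0 := by rw [hprod]; exact h0
  have key := hκ w (-u) h.symm.neg_right h0'
  rw [hprod] at key
  have hmax : max |((w : ℤ) : ℝ)| |((-u : ℤ) : ℝ)| = max |((u : ℤ) : ℝ)| |((w : ℤ) : ℝ)| := by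
    rw [Int.cast_neg, abs_neg, max_comm]
  rw [hmax] at key
  exact key

/-- **E4 [XS]** `RouteU → RouteW → CuspMinRadBound` (`κ := max (max κ_U κ_W) 0`, `min_le_left/right`). -/
theorem cuspMin_of_routes :
    (∀ ε : ℝ, 0 < ε → ∃ κ : ℝ, ∀ u w : ℤ, IsCoprime u w → u * w * (u ^ 2 - 11 * u * w - w ^ 2) ≠ 0 →
    Real.log (max (|(u : ℝ)|) (|(w : ℝ)|)) ≤
      κ * (((UniqueFactorizationMonoid.radical (u * w * (u ^ 2 - 11 * u * w - w ^ 2))).natAbs : ℕ) : ℝ) ^ (ε : ℝ) *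
        (((UniqueFactorizationMonoid.radical u).natAbs : ℕ) : ℝ)) →
    (∀ ε : ℝ, 0 < ε → ∃ κ : ℝ, ∀ u w : ℤ, IsCoprime u w → u * w * (u ^ 2 - 11 * u * w - w ^ 2) ≠ 0 →
    Real.log (max (|(u : ℝ)|) (|(w : ℝ)|)) ≤
      κ * (((UniqueFactorizationMonoid.radical (u * w * (u ^ 2 - 11 * u * w - w ^ 2))).natAbs : ℕ) : ℝ) ^ (ε : ℝ) *
        (((UniqueFactorizationMonoid.radical w).natAbs : ℕ) : ℝ)) →
    ∀ ε : ℝ, 0 < ε → ∃ κ : ℝ, ∀ u w : ℤ, IsCoprime u w → u * w * (u ^ 2 - 11 * u * w - w ^ 2) ≠ 0 →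
    Real.log (max (|(u : ℝ)|) (|(w : ℝ)|)) ≤
      κ * (((UniqueFactorizationMonoid.radical (u * w * (u ^ 2 - 11 * u * w - w ^ 2))).natAbs : ℕ) : ℝ) ^ (ε : ℝ) *
        min ((((UniqueFactorizationMonoid.radical u).natAbs : ℕ) : ℝ))
            ((((UniqueFactorizationMonoid.radical w).natAbs : ℕ) : ℝ)) := by
  intro hU hW ε hε
  obtain ⟨κ₁, h₁⟩ := hU ε hε
  obtain ⟨κ₂, h₂⟩ := hW ε hε
  refine ⟨max (max κ₁ κ₂) 0, fun u w h h0 => ?_⟩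
  have hR : 0 ≤ (((UniqueFactorizationMonoid.radical (u * w * (u ^ 2 - 11 * u * w - w ^ 2))).natAbs : ℕ) : ℝ)
      ^ (ε : ℝ) := Real.rpow_nonneg (Nat.cast_nonneg _) _
  have hk₁ : κ₁ ≤ max (max κ₁ κ₂) 0 := (le_max_left _ _).trans (le_max_left _ _)
  have hk₂ : κ₂ ≤ max (max κ₁ κ₂) 0 := (le_max_right _ _).trans (le_max_left _ _)
  rcases min_choice ((((UniqueFactorizationMonoid.radical u).natAbs : ℕ) : ℝ))
      ((((UniqueFactorizationMonoid.radical w).natAbs : ℕ) : ℝ)) with hmin | hmin <;> rw [hmin]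
  · exact (h₁ u w h h0).trans
      (mul_le_mul_of_nonneg_right (mul_le_mul_of_nonneg_right hk₁ hR) (Nat.cast_nonneg _))
  · exact (h₂ u w h h0).trans
      (mul_le_mul_of_nonneg_right (mul_le_mul_of_nonneg_right hk₂ hR) (Nat.cast_nonneg _))

/-- **E5 [S]** min-form ⇒ STUB: all radicals `≥ 1`, `min x y ≤ (xy)^{1/2} ≤ (xy)^{2/3}`, `1 ≤ (rad Q)^{1/3}` (`Real.one_le_rpow`). -/
theorem stubSplit_of_cuspMin :
    (∀ ε : ℝ, 0 < ε → ∃ κ : ℝ, ∀ u w : ℤ, IsCoprime u w → u * w * (u ^ 2 - 11 * u * w - w ^ 2) ≠ 0 →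
    Real.log (max (|(u : ℝ)|) (|(w : ℝ)|)) ≤
      κ * (((UniqueFactorizationMonoid.radical (u * w * (u ^ 2 - 11 * u * w - w ^ 2))).natAbs : ℕ) : ℝ) ^ (ε : ℝ) *
        min ((((UniqueFactorizationMonoid.radical u).natAbs : ℕ) : ℝ))
            ((((UniqueFactorizationMonoid.radical w).natAbs : ℕ) : ℝ))) →
    ∀ ε : ℝ, 0 < ε → ∃ κ : ℝ, ∀ u w : ℤ, IsCoprime u w → u * w * (u ^ 2 - 11 * u * w - w ^ 2) ≠ 0 → Real.log (max (|(u : ℝ)|) (|(w : ℝ)|)) ≤ κ * (((UniqueFactorizationMonoid.radical (u * w * (u ^ 2 - 11 * u * w - w ^ 2))).natAbs : ℕ) : ℝ) ^ (ε : ℝ) * (((((UniqueFactorizationMonoid.radical u).natAbs : ℕ) : ℝ) * (((UniqueFactorizationMonoid.radical w).natAbs : ℕ) : ℝ)) ^ (2 / 3 : ℝ) * (((UniqueFactorizationMonoid.radical (u ^ 2 - 11 * u * w - w ^ 2)).natAbs : ℕ) : ℝ) ^ (1 / 3 : ℝ)) := by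
  intro hC ε hε
  obtain ⟨κ, hκ⟩ := hC ε hε
  refine ⟨max κ 0, fun u w h h0 => ?_⟩
  have main := hκ u w h h0
  set R : ℝ := (((UniqueFactorizationMonoid.radical (u * w * (u ^ 2 - 11 * u * w - w ^ 2))).natAbs : ℕ) : ℝ)
    with hR
  set a : ℝ := (((UniqueFactorizationMonoid.radical u).natAbs : ℕ) : ℝ) with ha
  set b : ℝ := (((UniqueFactorizationMonoid.radical w).natAbs : ℕ) : ℝ) with hb
  set c : ℝ := (((UniqueFactorizationMonoid.radical (u ^ 2 - 11 * u * w - w ^ 2)).natAbs : ℕ) : ℝ) with hc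
  have ha1 : 1 ≤ a := one_le_radR u
  have hb1 : 1 ≤ b := one_le_radR w
  have hc1 : 1 ≤ c := one_le_radR _
  have hm0 : 0 ≤ min a b := le_min (by linarith) (by linarith)
  have hab : min a b ^ 2 ≤ a * b := by
    rw [sq]; exact mul_le_mul (min_le_left _ _) (min_le_right _ _) hm0 (by linarith)
  have hab1 : 1 ≤ a * b := one_le_mul_of_one_le_of_one_le ha1 hb1
  have hmin_le : min a b ≤ (a * b) ^ (2 / 3 : ℝ) * c ^ (1 / 3 : ℝ) :=
    calc min a b = Real.sqrt (min a b ^ 2) := (Real.sqrt_sq hm0).symm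
      _ ≤ Real.sqrt (a * b) := Real.sqrt_le_sqrt hab
      _ = (a * b) ^ (1 / 2 : ℝ) := Real.sqrt_eq_rpow _
      _ ≤ (a * b) ^ (2 / 3 : ℝ) := Real.rpow_le_rpow_of_exponent_le hab1 (by norm_num)
      _ = (a * b) ^ (2 / 3 : ℝ) * 1 := (mul_one _).symm
      _ ≤ (a * b) ^ (2 / 3 : ℝ) * c ^ (1 / 3 : ℝ) :=
          mul_le_mul_of_nonneg_left (Real.one_le_rpow hc1 (by norm_num)) (Real.rpow_nonneg (by linarith) _)
  have hR0 : 0 ≤ R := Nat.cast_nonneg _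
  have hRε : 0 ≤ R ^ (ε : ℝ) := Real.rpow_nonneg hR0 _
  have hκ0 : 0 ≤ max κ 0 := le_max_right _ _
  calc Real.log (max |(u : ℝ)| |(w : ℝ)|) ≤ κ * R ^ (ε : ℝ) * min a b := main
    _ ≤ max κ 0 * R ^ (ε : ℝ) * min a b :=
        mul_le_mul_of_nonneg_right (mul_le_mul_of_nonneg_right (le_max_left _ _) hRε) hm0
    _ ≤ max κ 0 * R ^ (ε : ℝ) * ((a * b) ^ (2 / 3 : ℝ) * c ^ (1 / 3 : ℝ)) :=
        mul_le_mul_of_nonneg_left hmin_le (mul_nonneg hκ0 hRε)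

/-- **E6 [S]** min-form ⇒ CRUX (statement of `CuspFieldPencil.GoldenCuspShadow`, unfolded): `min(rad u, rad w) ≤ (rad u·rad w)^{1/2} ≤ R^{1/2}`,
`R^ε·R^{1/2} = R^{1/2+ε}` (`Real.rpow_add`). [folklore] -/
theorem goldenCuspShadow_of_cuspMin :
    (∀ ε : ℝ, 0 < ε → ∃ κ : ℝ, ∀ u w : ℤ, IsCoprime u w → u * w * (u ^ 2 - 11 * u * w - w ^ 2) ≠ 0 →
    Real.log (max (|(u : ℝ)|) (|(w : ℝ)|)) ≤
      κ * (((UniqueFactorizationMonoid.radical (u * w * (u ^ 2 - 11 * u * w - w ^ 2))).natAbs : ℕ) : ℝ) ^ (ε : ℝ) *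
        min ((((UniqueFactorizationMonoid.radical u).natAbs : ℕ) : ℝ))
            ((((UniqueFactorizationMonoid.radical w).natAbs : ℕ) : ℝ))) →
    ∀ ε : ℝ, 0 < ε → ∃ κ : ℝ, ∀ u w : ℤ, IsCoprime u w → u * w * (u ^ 2 - 11 * u * w - w ^ 2) ≠ 0 →
    Real.log (max (|(u : ℝ)|) (|(w : ℝ)|)) ≤
      κ * (((UniqueFactorizationMonoid.radical (u * w * (u ^ 2 - 11 * u * w - w ^ 2))).natAbs : ℕ) : ℝ) ^ (1 / 2 + ε : ℝ) := by
  intro hC ε hε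
  obtain ⟨κ, hκ⟩ := hC ε hε
  refine ⟨max κ 0, fun u w h h0 => ?_⟩
  have main := hκ u w h h0
  set R : ℝ := (((UniqueFactorizationMonoid.radical (u * w * (u ^ 2 - 11 * u * w - w ^ 2))).natAbs : ℕ) : ℝ)
    with hR
  set a : ℝ := (((UniqueFactorizationMonoid.radical u).natAbs : ℕ) : ℝ) with ha
  set b : ℝ := (((UniqueFactorizationMonoid.radical w).natAbs : ℕ) : ℝ) with hb
  set c : ℝ := (((UniqueFactorizationMonoid.radical (u ^ 2 - 11 * u * w - w ^ 2)).natAbs : ℕ) : ℝ) with hc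
  have ha1 : 1 ≤ a := one_le_radR u
  have hb1 : 1 ≤ b := one_le_radR w
  have hc1 : 1 ≤ c := one_le_radR _
  have hRabc : R = a * b * c := radR_prod h
  have hRpos : 0 < R := by rw [hRabc]; exact mul_pos (mul_pos (by linarith) (by linarith)) (by linarith)
  have hm0 : 0 ≤ min a b := le_min (by linarith) (by linarith)
  have hmin_sq : min a b ^ 2 ≤ R := by
    rw [hRabc, sq]
    calc min a b * min a b ≤ a * b := mul_le_mul (min_le_left _ _) (min_le_right _ _) hm0 (by linarith)
      _ ≤ a * b * c := le_mul_of_one_le_right (mul_nonneg (by linarith) (by linarith)) hc1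
  have hmin_le : min a b ≤ R ^ (1 / 2 : ℝ) := by
    rw [← Real.sqrt_eq_rpow, ← Real.sqrt_sq hm0]
    exact Real.sqrt_le_sqrt hmin_sq
  have hRε : 0 ≤ R ^ (ε : ℝ) := Real.rpow_nonneg hRpos.le _
  have hκ0 : 0 ≤ max κ 0 := le_max_right _ _
  calc Real.log (max |(u : ℝ)| |(w : ℝ)|) ≤ κ * R ^ (ε : ℝ) * min a b := main
    _ ≤ max κ 0 * R ^ (ε : ℝ) * min a b :=
        mul_le_mul_of_nonneg_right (mul_le_mul_of_nonneg_right (le_max_left _ _) hRε) hm0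
    _ ≤ max κ 0 * R ^ (ε : ℝ) * R ^ (1 / 2 : ℝ) := mul_le_mul_of_nonneg_left hmin_le (mul_nonneg hκ0 hRε)
    _ = max κ 0 * R ^ (1 / 2 + ε : ℝ) := by rw [Real.rpow_add hRpos]; ring

/-! ## §3 Assembly: kernel theorem ⇒ `RouteU` ⇒ `RouteW` ⇒ min-form ⇒ STUB ∧ CRUX by name -/

/-- `RouteU` holds: the engine hypothesis is discharged by the kernel theorem `approximationBound_rat_holds`
(route `YuMatveevShapeRat`; [cite: Pasten2024, Theorem 2.1 (d = 1)]). -/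
theorem routeU_holds :
    ∀ ε : ℝ, 0 < ε → ∃ κ : ℝ, ∀ u w : ℤ, IsCoprime u w → u * w * (u ^ 2 - 11 * u * w - w ^ 2) ≠ 0 →
    Real.log (max (|(u : ℝ)|) (|(w : ℝ)|)) ≤
      κ * (((UniqueFactorizationMonoid.radical (u * w * (u ^ 2 - 11 * u * w - w ^ 2))).natAbs : ℕ) : ℝ) ^ (ε : ℝ) *
        (((UniqueFactorizationMonoid.radical u).natAbs : ℕ) : ℝ) := by
  obtain ⟨K, hK, hP⟩ := approximationBound_rat_holds
  exact routeU_of_engine hK hP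

/-- `RouteW` holds (cusp swap). [folklore] -/
theorem routeW_holds :
    ∀ ε : ℝ, 0 < ε → ∃ κ : ℝ, ∀ u w : ℤ, IsCoprime u w → u * w * (u ^ 2 - 11 * u * w - w ^ 2) ≠ 0 →
    Real.log (max (|(u : ℝ)|) (|(w : ℝ)|)) ≤
      κ * (((UniqueFactorizationMonoid.radical (u * w * (u ^ 2 - 11 * u * w - w ^ 2))).natAbs : ℕ) : ℝ) ^ (ε : ℝ) *
        (((UniqueFactorizationMonoid.radical w).natAbs : ℕ) : ℝ) := routeW_of_routeU routeU_holds

/-- The min-form `log H ≤ κ_ε R^ε · min(rad u, rad w)` holds. [folklore] -/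
theorem cuspMinRadBound_holds :
    ∀ ε : ℝ, 0 < ε → ∃ κ : ℝ, ∀ u w : ℤ, IsCoprime u w → u * w * (u ^ 2 - 11 * u * w - w ^ 2) ≠ 0 →
    Real.log (max (|(u : ℝ)|) (|(w : ℝ)|)) ≤
      κ * (((UniqueFactorizationMonoid.radical (u * w * (u ^ 2 - 11 * u * w - w ^ 2))).natAbs : ℕ) : ℝ) ^ (ε : ℝ) *
        min ((((UniqueFactorizationMonoid.radical u).natAbs : ℕ) : ℝ))
            ((((UniqueFactorizationMonoid.radical w).natAbs : ℕ) : ℝ)) := cuspMin_of_routes routeU_holds routeW_holds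


end GoldenCuspShadowBaker



/-- **Registered stub `stub_splitCuspTriple`** of the birth skeleton of stmt-ABC-26026 (verbatim signature):
`log max(|u|,|w|) ≤ κ_ε · rad(uwQ)^ε · (rad u · rad w)^{2/3} · rad(Q)^{1/3}`. [folklore] -/
theorem stub_splitCuspTriple : ∀ ε : ℝ, 0 < ε → ∃ κ : ℝ, ∀ u w : ℤ, IsCoprime u w → u * w * (u ^ 2 - 11 * u * w - w ^ 2) ≠ 0 → Real.log (max (|(u : ℝ)|) (|(w : ℝ)|)) ≤ κ * (((UniqueFactorizationMonoid.radical (u * w * (u ^ 2 - 11 * u * w - w ^ 2))).natAbs : ℕ) : ℝ) ^ (ε : ℝ) * (((((UniqueFactorizationMonoid.radical u).natAbs : ℕ) : ℝ) * (((UniqueFactorizationMonoid.radical w).natAbs : ℕ) : ℝ)) ^ (2 / 3 : ℝ) * (((UniqueFactorizationMonoid.radical (u ^ 2 - 11 * u * w - w ^ 2)).natAbs : ℕ) : ℝ) ^ (1 / 3 : ℝ)) :=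
  GoldenCuspShadowBaker.stubSplit_of_cuspMin GoldenCuspShadowBaker.cuspMinRadBound_holds

/-- **Crux stmt-ABC-26026 `CuspFieldPencil.GoldenCuspShadow` holds** (unconditionally, from the Baker-method
approximation bound over `ℚ`): `log max(|u|,|w|) ≤ κ_ε · rad(u·w·(u² − 11uw − w²))^{1/2+ε}` for coprime `u, w`.
[cite: Pasten2024, Theorem 2.1] [cite: EvertseGyory2015, §4.6] -/
theorem goldenCuspShadow_proof : Summit.ABC.ABC.Theses.CuspFieldPencil.GoldenCuspShadow :=
  GoldenCuspShadowBaker.goldenCuspShadow_of_cuspMin GoldenCuspShadowBaker.cuspMinRadBound_holds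

end Summit.ABC.ABC.Theorems

end
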